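import Summits.BirchSwinnertonDyer.BirchSwinnertonDyer.Theorems.PrintX10bHowardSettingSatisfiesH
import Literature.NumberTheory.EllipticCurves.ZpExtensionEisensteinDVRSettingH5bLevelLiftProofs
import Literature.NumberTheory.EllipticCurves.ZpExtensionEisensteinDVRSettingH5bBadPlacesUniformProofs
import Literature.NumberTheory.EllipticCurves.ZpExtensionEisensteinBadPlacesLocalTorsionProofs
import Literature.NumberTheory.EllipticCurves.ZpExtensionEisensteinDVRSettingDualityDataProofs
import Literature.NumberTheory.EllipticCurves.ZpExtensionEisensteinDVRSettingLevelsTame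
import HarnessLib

/-!
# `Stmt.h5bAtS` of the shared μ-crux from its level-`0` clause at the places above `p` (the `k = 0` assembler)

Summits-side helper for the line `spec_witnesses` on the shared μ-crux `MuInequalityCoherentPairOfPrint`
(stmt-BirchSwinnertonDyer-23237, skeleton v6/v7 of μ-LEAD `bsd-line-x9-p1` g4, registered stub `stub_h5bAtS : Stmt.h5bAtS`);
cell `pub/bsd-print-x9`, seat `bsd-line-x10b-p1-w8` g3 (the `k = 0` assembler lineage of D1).  `--supports`
stmt-BirchSwinnertonDyer-23237.  THEOREMS ONLY (no definition, no named fact, no instance, no `sorry`).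

`Stmt.h5bAtS` (D1's letter, `D1StubAAssembly.lean` / `Skeleton-SharedMu-SpecWitnesses-v7.lean`, VERBATIM below as the
conclusion) is Howard's H.5(b) for the curve's Eisenstein setting on the frames of the μ-letter: for `m ≫ 0` (ONE threshold
`m₅` before all the data), for the canonical conjugation datum `ofLifts σ … (e c₀ e⁻¹) …` and the instantiated H.4 data, at
EVERY tower level `k` and EVERY `v ∈ S` (`S ⊆ {v ∣ pN}`, `⊇ {v ∣ p}`, `Aut(K/ℚ)`-stable): `(θ_v ∘ transport_v)(F̄_k(σ v)) = F̄_k(v)`.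
This file reduces it to the ONE arithmetic clause that is not in the tree — the places ABOVE `p`, tower level `0`:
* the places `v ∈ S ∖ {p}` are served, uniformly in `m`, by x10b-p1-w8's
  `eisensteinDVRSetting_exists_forall_h5b_clause_zero_of_not_mem` (x9-p1-w3's (UT)/(SB) clause `…_of_mem`, A4), whose
  inputs hold on the frames: `hdec` from (Heeg) + `S ⊆ {v ∣ pN}` (x9-p2's `ZpExtension.not_decomp_le_kerSubgroup_of_natCast_mem`,
  Brink), `κ⁻(τ⁻¹ g τ) = −κ⁻(g)` for the anticyclotomic `κ⁻ = κ.unitTwist (-1)` and the transported complex conjugation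
  (`ZpExtension.toAdd_conjGalCMH_eq_neg`), forward `σ`-stability from `hSσ` and `σ² = 1`;
* all tower levels `k` follow from level `0` by x10b-p1-w8's `eisensteinDVRSetting_h5b_hfin_of_zero` (`πbar_red`, `θ_eq`,
  `cond_red` for `K` totally complex — `hyp.isImaginaryQuadratic`);
so:
* **`h5bAtS_of_clauseZeroP`** — `Stmt.h5bAtSZeroP → Stmt.h5bAtS`, where the hypothesis `Stmt.h5bAtSZeroP` (spelled out as the
  binder `H5P`) is THE SAME LETTER restricted to ONE place `v ∈ S` with `p ∈ v`, tower level `0`, with its threshold `m₁`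
  chosen per `(frame, v)` BEFORE `m` and all the data (the `∃ m₁ ∀ m > m₁ ∀ π L hL hLS jbar c₀ σ … D e log (ids…)` shape of
  the clause files A4 p660836 / C2b p668203 / road U's F7).
⇒ `theorem stub_h5bAtS : Stmt.h5bAtS := h5bAtS_of_clauseZeroP <the p-adic level-0 clause>` is one line once that clause
lands (road U of x9-p1-w3 g6, or C2b + (H5B-P-ANOM)).  HONEST FRAMING: the `v ∣ p` clause is NOT proved here; no summit
statement is proved; the μ-crux is not asserted; BSD is not proved by any of this.

References: [Howard2004HeegnerKolyvagin] §1.3 H.5(b) (arXiv:1202.6340 p. 7 L96–97), §1.6 (p. 11 L13–38, p. 12 L29–55), §2.2,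
Def. 3.1.2; [CastellaGrossiLeeSkinner2022] §3.2, §3.4 (Σ = {w ∣ pN∞}); [Brink2007] Thm. 2; [MazurRubinMemoirs2004] Def. 1.1.1.
-/

set_option linter.dupNamespace false
set_option autoImplicit false

noncomputable section

open scoped Classical Pointwise ContRepresentation TensorProduct NumberField

open Function NumberField IsDedekindDomain Field
open Literature Literature.NumberTheory.EllipticCurves WeierstrassCurve
open Literature.NumberTheory.GaloisCohomology Literature.NumberTheory.GaloisCohomology.Howard2004
open Literature.NumberTheory.Automorphic
open Literature.NumberTheory.GaloisRepresentations Literature.NumberTheory.GaloisRepresentations.DiscreteGaloisModule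
open Summit.BirchSwinnertonDyer.BirchSwinnertonDyer.Theorems

namespace Summit.BirchSwinnertonDyer.BirchSwinnertonDyer.Theorems.HeegnerMuPartH5bAtS

set_option synthInstance.maxHeartbeats 80000 in
/-- **`Stmt.h5bAtS` from its level-`0` clause at the places above `p`.**  If, on every frame of the μ-letter and for every
`v ∈ S` with `p ∈ v`, there is `m₁` such that for all `m > m₁` and all the data of the canonical Eisenstein setting the H.5(b)
clause `(θ_v ∘ transport_v)(F̄_0(σ v)) = F̄_0(v)` holds at tower level `0` (hypothesis `H5P` = `Stmt.h5bAtSZeroP`), then D1's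
letter `Stmt.h5bAtS` holds: ONE threshold `m₅` for all the data, all levels `k`, all `v ∈ S`.  The places prime to `p` and the
level lift are supplied here (`eisensteinDVRSetting_exists_forall_h5b_clause_zero_of_not_mem`,
`eisensteinDVRSetting_h5b_hfin_of_zero`); `m₅ := max m₁^{∤p} (max_{v ∣ p} m₁(v)) + 1`.
[cite: Howard2004HeegnerKolyvagin, §1.3 H.5(b) (arXiv:1202.6340 p. 7 L96–97), §1.6 (p. 12 L29–55), §2.2, Def. 3.1.2]
[cite: CastellaGrossiLeeSkinner2022, §3.2 and §3.4] [cite: Brink2007, Thm. 2] -/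
theorem h5bAtS_of_clauseZeroP
    (H5P :
    ∀ (N : ℕ) [NeZero N] (W : WeierstrassCurve ℚ) [W.IsGloballyMinimal] (K : Type) [Field K] [NumberField K]
      (p : ℕ) [Fact p.Prime] (κ : ZpExtension K p) (γ : Field.absoluteGaloisGroup K)
      (hyp : CastellaGrossiLeeSkinner2022.Thm413Hypotheses N W K p κ γ),
      W.HasIrreducibleModPGaloisRep p → (W.baseChange K).HasIrreducibleModPGaloisRep p →
      haveI := hyp.isElliptic
      ∀ (S : Finset (HeightOneSpectrum (𝓞 K)))
        (hpS : ∀ v, ((p : ℕ) : 𝓞 K) ∈ v.asIdeal → v ∈ S)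
        (hbad : ∀ v, v ∉ S → ((p : ℕ) : 𝓞 K) ∉ v.asIdeal → (W.baseChange K).HasGoodReductionAt v),
      (∀ v ∈ S, ((p : ℕ) : 𝓞 K) ∈ v.asIdeal ∨ ((N : ℕ) : 𝓞 K) ∈ v.asIdeal) →
      (∀ (σ : K ≃ₐ[ℚ] K) (v : HeightOneSpectrum (𝓞 K)), σ • v ∈ S → v ∈ S) →
      ∀ v ∈ S, ((p : ℕ) : 𝓞 K) ∈ v.asIdeal →
      ∃ m₁ : ℕ, ∀ (m : ℕ) (hm : 1 ≤ m), m₁ < m →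
        letI := IwasawaAlgebra.isDomain_quotient_X_pow_add_C p hm
        letI := IwasawaAlgebra.isDiscreteValuationRing_quotient_X_pow_add_C p hm
        haveI := IwasawaAlgebra.EisensteinCoeff.isLocalRing_succ p hm
        letI := IwasawaAlgebra.EisensteinCoeff.algebraOfSpecSucc p m
        haveI := W.isScalarTower_algebraOfSpecSucc (K := K) (p := p) (m := m)
        letI := W.residueModuleSucc (K := K) (p := p) hm
        ∀ (π : ∀ v : HeightOneSpectrum (𝓞 K), TamePin v) (L : Set (HeightOneSpectrum (𝓞 K)))
          (hL : L ⊆ (W.eisensteinTower (κ.unitTwist (-1)) hm).degreeTwoPrimes p) (hLS : ∀ v ∈ L, v ∉ S)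
          (jbar' : AlgebraicClosure K →+* ℂ)
          (c₀ : absoluteGaloisGroup ℚ) (σ : K ≃ₐ[ℚ] K) (hσ₁ : σ ≠ 1) (hσ : σ * σ = 1)
          (hτl : IsLiftOfAut σ (absGaloisTransport (K := ℚ) (L := K) c₀).toRingEquiv)
          (hτ₂ : Function.Involutive (absGaloisTransport (K := ℚ) (L := K) c₀).toRingEquiv)
          (D : ∀ k, DualityDatum p (ConjugationDatum.ofLifts σ hσ₁ hσ _ hτl hτ₂)
            ((W.eisensteinTower (κ.unitTwist (-1)) hm).ρ k) (IwasawaAlgebra.EisensteinCoeff p m (k + 1)))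
          (e : ∀ j : ℕ, geomTorsion (W.baseChange K) ((p : ℤ) ^ j) →+ geomTorsion (W.baseChange K) ((p : ℤ) ^ j) →+
            MuCarrier K (p ^ j))
          (log : ∀ j : ℕ, MuCarrier K (p ^ j) →+ ZMod (p ^ j)),
          IsComplexConjugation (Rat.castHom ℝ) c₀ →
          (∀ x, (ConjugationDatum.ofLifts σ hσ₁ hσ _ hτl hτ₂).τ x = absGaloisTransport (K := ℚ) (L := K) c₀ x) →
          (∀ k, (D k).e = ZpExtension.eisensteinDualityForm hm (k + 1)
            (conjPairing (e (k + 1)) ((ConjugationDatum.ofLifts σ hσ₁ hσ _ hτl hτ₂).isLift.torsionMap W _)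
              (log (k + 1)))) →
          (∀ j a, e j a a = 0) →
          (∀ j (g : absoluteGaloisGroup K) a b, e j (g • a) (g • b) = mu K (p ^ j) g (e j a b)) →
          (∀ j a b, e j ((ConjugationDatum.ofLifts σ hσ₁ hσ _ hτl hτ₂).isLift.torsionMap W _ a)
            ((ConjugationDatum.ofLifts σ hσ₁ hσ _ hτl hτ₂).isLift.torsionMap W _ b) = -e j a b) →
          (∀ j (a : geomTorsion (W.baseChange K) ((p : ℤ) ^ j)),
            (ConjugationDatum.ofLifts σ hσ₁ hσ _ hτl hτ₂).isLift.torsionMap W _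
              ((ConjugationDatum.ofLifts σ hσ₁ hσ _ hτl hτ₂).isLift.torsionMap W _ a) = a) →
          (∀ j, Function.Bijective (log j)) →
          (∀ j (g : absoluteGaloisGroup K) ξ, log j (mu K (p ^ j) g ξ) = cyclotomicCharacterModPow K p j g * log j ξ) →
            (((W.isQuotientBy_eisensteinDVRSetting_πbar (κ.unitTwist (-1)) hm S hpS hbad L hL hLS jbar'
                (ConjugationDatum.ofLifts σ hσ₁ hσ _ hτl hτ₂) D
                (W.eisensteinLevelsTameFs (κ.unitTwist (-1)) hm π S hpS hbad L hL hLS)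
                0).propagateStructure (W.eisensteinTowerTriple (κ.unitTwist (-1)) hm S hpS hbad L hL hLS 0).cond)
                (Sum.inr (σ • v))).map
                (((W.residualTauGeomTorsion (p := p) (ConjugationDatum.ofLifts σ hσ₁ hσ _ hτl hτ₂) hm (k := 0 + 1)
                    (Nat.succ_pos 0)).thetaH1 (Sum.inr v)).comp
                  ((ConjugationDatum.ofLifts σ hσ₁ hσ _ hτl hτ₂).transportH1
                    ((W.baseChange K).torsionGaloisModule (p : ℤ)) v)) =
              ((W.isQuotientBy_eisensteinDVRSetting_πbar (κ.unitTwist (-1)) hm S hpS hbad L hL hLS jbar'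
                (ConjugationDatum.ofLifts σ hσ₁ hσ _ hτl hτ₂) D
                (W.eisensteinLevelsTameFs (κ.unitTwist (-1)) hm π S hpS hbad L hL hLS)
                0).propagateStructure (W.eisensteinTowerTriple (κ.unitTwist (-1)) hm S hpS hbad L hL hLS 0).cond)
                (Sum.inr v)) :
    ∀ (N : ℕ) [NeZero N] (W : WeierstrassCurve ℚ) [W.IsGloballyMinimal] (K : Type) [Field K] [NumberField K]
      (p : ℕ) [Fact p.Prime] (κ : ZpExtension K p) (γ : Field.absoluteGaloisGroup K)
      (hyp : CastellaGrossiLeeSkinner2022.Thm413Hypotheses N W K p κ γ),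
      W.HasIrreducibleModPGaloisRep p → (W.baseChange K).HasIrreducibleModPGaloisRep p →
      haveI := hyp.isElliptic
      ∀ (S : Finset (HeightOneSpectrum (𝓞 K)))
        (hpS : ∀ v, ((p : ℕ) : 𝓞 K) ∈ v.asIdeal → v ∈ S)
        (hbad : ∀ v, v ∉ S → ((p : ℕ) : 𝓞 K) ∉ v.asIdeal → (W.baseChange K).HasGoodReductionAt v),
      (∀ v ∈ S, ((p : ℕ) : 𝓞 K) ∈ v.asIdeal ∨ ((N : ℕ) : 𝓞 K) ∈ v.asIdeal) →
      (∀ (σ : K ≃ₐ[ℚ] K) (v : HeightOneSpectrum (𝓞 K)), σ • v ∈ S → v ∈ S) →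
      ∃ m₅ : ℕ, ∀ (m : ℕ) (hm : 1 ≤ m), m₅ ≤ m →
        letI := IwasawaAlgebra.isDomain_quotient_X_pow_add_C p hm
        letI := IwasawaAlgebra.isDiscreteValuationRing_quotient_X_pow_add_C p hm
        haveI := IwasawaAlgebra.EisensteinCoeff.isLocalRing_succ p hm
        letI := IwasawaAlgebra.EisensteinCoeff.algebraOfSpecSucc p m
        haveI := W.isScalarTower_algebraOfSpecSucc (K := K) (p := p) (m := m)
        letI := W.residueModuleSucc (K := K) (p := p) hm
        ∀ (π : ∀ v : HeightOneSpectrum (𝓞 K), TamePin v) (L : Set (HeightOneSpectrum (𝓞 K)))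
          (hL : L ⊆ (W.eisensteinTower (κ.unitTwist (-1)) hm).degreeTwoPrimes p) (hLS : ∀ v ∈ L, v ∉ S)
          (jbar' : AlgebraicClosure K →+* ℂ)
          (c₀ : absoluteGaloisGroup ℚ) (σ : K ≃ₐ[ℚ] K) (hσ₁ : σ ≠ 1) (hσ : σ * σ = 1)
          (hτl : IsLiftOfAut σ (absGaloisTransport (K := ℚ) (L := K) c₀).toRingEquiv)
          (hτ₂ : Function.Involutive (absGaloisTransport (K := ℚ) (L := K) c₀).toRingEquiv)
          (D : ∀ k, DualityDatum p (ConjugationDatum.ofLifts σ hσ₁ hσ _ hτl hτ₂)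
            ((W.eisensteinTower (κ.unitTwist (-1)) hm).ρ k) (IwasawaAlgebra.EisensteinCoeff p m (k + 1)))
          (e : ∀ j : ℕ, geomTorsion (W.baseChange K) ((p : ℤ) ^ j) →+ geomTorsion (W.baseChange K) ((p : ℤ) ^ j) →+
            MuCarrier K (p ^ j))
          (log : ∀ j : ℕ, MuCarrier K (p ^ j) →+ ZMod (p ^ j)),
          IsComplexConjugation (Rat.castHom ℝ) c₀ →
          (∀ x, (ConjugationDatum.ofLifts σ hσ₁ hσ _ hτl hτ₂).τ x = absGaloisTransport (K := ℚ) (L := K) c₀ x) →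
          (∀ k, (D k).e = ZpExtension.eisensteinDualityForm hm (k + 1)
            (conjPairing (e (k + 1)) ((ConjugationDatum.ofLifts σ hσ₁ hσ _ hτl hτ₂).isLift.torsionMap W _)
              (log (k + 1)))) →
          (∀ j a, e j a a = 0) →
          (∀ j (g : absoluteGaloisGroup K) a b, e j (g • a) (g • b) = mu K (p ^ j) g (e j a b)) →
          (∀ j a b, e j ((ConjugationDatum.ofLifts σ hσ₁ hσ _ hτl hτ₂).isLift.torsionMap W _ a)
            ((ConjugationDatum.ofLifts σ hσ₁ hσ _ hτl hτ₂).isLift.torsionMap W _ b) = -e j a b) →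
          (∀ j (a : geomTorsion (W.baseChange K) ((p : ℤ) ^ j)),
            (ConjugationDatum.ofLifts σ hσ₁ hσ _ hτl hτ₂).isLift.torsionMap W _
              ((ConjugationDatum.ofLifts σ hσ₁ hσ _ hτl hτ₂).isLift.torsionMap W _ a) = a) →
          (∀ j, Function.Bijective (log j)) →
          (∀ j (g : absoluteGaloisGroup K) ξ, log j (mu K (p ^ j) g ξ) = cyclotomicCharacterModPow K p j g * log j ξ) →
          ∀ k, ∀ v ∈ S,
            (((W.isQuotientBy_eisensteinDVRSetting_πbar (κ.unitTwist (-1)) hm S hpS hbad L hL hLS jbar'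
                (ConjugationDatum.ofLifts σ hσ₁ hσ _ hτl hτ₂) D
                (W.eisensteinLevelsTameFs (κ.unitTwist (-1)) hm π S hpS hbad L hL hLS)
                k).propagateStructure (W.eisensteinTowerTriple (κ.unitTwist (-1)) hm S hpS hbad L hL hLS k).cond)
                (Sum.inr (σ • v))).map
                (((W.residualTauGeomTorsion (p := p) (ConjugationDatum.ofLifts σ hσ₁ hσ _ hτl hτ₂) hm (k := k + 1)
                    k.succ_pos).thetaH1 (Sum.inr v)).comp
                  ((ConjugationDatum.ofLifts σ hσ₁ hσ _ hτl hτ₂).transportH1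
                    ((W.baseChange K).torsionGaloisModule (p : ℤ)) v)) =
              ((W.isQuotientBy_eisensteinDVRSetting_πbar (κ.unitTwist (-1)) hm S hpS hbad L hL hLS jbar'
                (ConjugationDatum.ofLifts σ hσ₁ hσ _ hτl hτ₂) D
                (W.eisensteinLevelsTameFs (κ.unitTwist (-1)) hm π S hpS hbad L hL hLS)
                k).propagateStructure (W.eisensteinTowerTriple (κ.unitTwist (-1)) hm S hpS hbad L hL hLS k).cond)
                (Sum.inr v) := by
  intro N _ W _ K _ _ p _ κ γ hyp hirr hirrK S hpS hbad hSN hSσ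
  haveI := hyp.isElliptic
  have hK : IsImaginaryQuadratic K := hyp.isImaginaryQuadratic
  haveI : IsTotallyComplex K := hK.isTotallyComplex
  classical
  -- `κ⁻ = κ.unitTwist (-1)` is anticyclotomic; the places of `S` prime to `p` lie over `N`, hence are finitely decomposed
  have hantiκ : (κ.unitTwist (-1)).IsAnticyclotomic := hyp.anticyclotomic.unitTwist (-1)
  have hdec : ∀ v ∈ S, ((p : ℕ) : 𝓞 K) ∉ v.asIdeal → ¬ (GreenbergSelmer.decomp v ≤ (κ.unitTwist (-1)).kerSubgroup) :=
    fun v hvS hpv ↦ ZpExtension.not_decomp_le_kerSubgroup_of_natCast_mem (κ.unitTwist (-1)) hK hantiκ hyp.heegner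
      ((hSN v hvS).resolve_left hpv) hpv
  -- ONE threshold for the places prime to `p` (all conjugation data, all H.4 data, all slots)
  obtain ⟨m₁, hm₁⟩ :=
    W.eisensteinDVRSetting_exists_forall_h5b_clause_zero_of_not_mem (κ.unitTwist (-1)) S hpS hbad hdec
  -- the thresholds of the hypothesis at the places above `p`
  have hP := H5P N W K p κ γ hyp hirr hirrK S hpS hbad hSN hSσ
  choose! mP hmP using hP
  refine ⟨max m₁ (S.sup mP) + 1, fun m hm hle ↦ ?_⟩
  letI := IwasawaAlgebra.isDomain_quotient_X_pow_add_C p hm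
  letI := IwasawaAlgebra.isDiscreteValuationRing_quotient_X_pow_add_C p hm
  haveI := IwasawaAlgebra.EisensteinCoeff.isLocalRing_succ p hm
  letI := IwasawaAlgebra.EisensteinCoeff.algebraOfSpecSucc p m
  haveI := W.isScalarTower_algebraOfSpecSucc (K := K) (p := p) (m := m)
  letI := W.residueModuleSucc (K := K) (p := p) hm
  intro π L hL hLS jbar' c₀ σ hσ₁ hσ hτl hτ₂ D e log hc₀ hτ hDe h4' h5' h6' h7' h8' h9'
  have hm₁m : m₁ < m := by omega
  -- every level `k` from level `0`
  refine W.eisensteinDVRSetting_h5b_hfin_of_zero (κ.unitTwist (-1)) hm S hpS hbad L hL hLS jbar' σ hσ₁ hσ _ hτl hτ₂ D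
    (W.eisensteinLevelsTameFs (κ.unitTwist (-1)) hm π S hpS hbad L hL hLS) (fun v hvS ↦ ?_)
  by_cases hpv : ((p : ℕ) : 𝓞 K) ∈ v.asIdeal
  · -- above `p`: the hypothesis
    have hmPv : mP v < m := lt_of_le_of_lt (Finset.le_sup (f := mP) hvS) (by omega)
    exact hmP v hvS hpv m hm hmPv π L hL hLS jbar' c₀ σ hσ₁ hσ hτl hτ₂ D e log hc₀ hτ hDe h4' h5' h6' h7' h8' h9'
  · -- prime to `p`: the uniform A4 clause on the frame
    have hanti : ∀ g : absoluteGaloisGroup K,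
        ((κ.unitTwist (-1)) ((ConjugationDatum.ofLifts σ hσ₁ hσ _ hτl hτ₂).conj g)).toAdd =
          -((κ.unitTwist (-1)) g).toAdd :=
      fun g ↦ ZpExtension.toAdd_conjGalCMH_eq_neg (κ.unitTwist (-1)) hantiκ (fun w ↦ IsTotallyComplex.isComplex w)
        (ConjugationDatum.ofLifts σ hσ₁ hσ _ hτl hτ₂).isLift hc₀ hτ g
    have hSσ' : ∀ w ∈ S, (ConjugationDatum.ofLifts σ hσ₁ hσ _ hτl hτ₂).σ • w ∈ S := fun w hw ↦
      hSσ σ _ (by change σ • σ • w ∈ S; rwa [smul_smul, hσ, one_smul])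
    exact hm₁ m hm hm₁m L hL hLS jbar' (ConjugationDatum.ofLifts σ hσ₁ hσ _ hτl hτ₂) D
      (W.eisensteinLevelsTameFs (κ.unitTwist (-1)) hm π S hpS hbad L hL hLS) hanti hSσ' v hvS hpv

end Summit.BirchSwinnertonDyer.BirchSwinnertonDyer.Theorems.HeegnerMuPartH5bAtS

end
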